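import Summits.AnomalousDissipation.AnomalousDissipation.Theorems.SolenoidalFractalHomogenisationLagrangianCarrierDeviation
import Mathlib.Analysis.Calculus.FDeriv.Comp
import Mathlib.Analysis.Calculus.MeanValue
import HarnessLib

/-!
# K3L `LagrangianCarrierConstruction` (stmt-AnomalousDissipation-24913), line `birth`, stub `stub_regularL`: the `C^{1,1}` calculus of
# near-identity maps (helper; `--supports stmt-AnomalousDissipation-24913`)

Summits-side helper file (everything proved; no definitions, no named facts). Generic normed-space bookkeeping for differentiable
self-maps `f : V → V` described by two numbers — a DISTORTION bound `‖Df(z) − id‖ ≤ δ` and a CURVATURE bound `‖Df(z) − Df(z')‖ ≤ β‖z − z'‖`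
(Lipschitz constant of the derivative): such maps are `(1+δ)`-Lipschitz (`lipschitzWith_of_norm_fderiv_sub_id_le`); the two numbers of a
composition `f ∘ g` are `δ_f + δ_g + δ_f δ_g` and `β_f (1+δ_g)² + (1+δ_f) β_g` (`norm_fderiv_comp_sub_id_le`,
`norm_fderiv_comp_sub_fderiv_comp_le`); and the CONJUGATED form used by the distortion tower of the Lagrangian carrier: if `f ∘ g = h`
then `‖D(f ∘ ψ ∘ g)(z) − id‖ ≤ (1+δ_f) ε (1+δ_g) + β_f η (1+δ_g) + ‖Dh(z) − id‖`, where `‖Dψ − id‖ ≤ ε` and `‖ψ(y) − y‖ ≤ η`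
(`norm_fderiv_conj_sub_id_le`) — inserting a map `ψ` that is `C¹`-close to the identity AND displaces little costs little, however
large the distortions of `f` and `g` themselves (this is what lets the frame distortion of level `m+1` over a short time span be compared
with that of level `m` over the SAME span: Armstrong–Vicol, arXiv:2305.05048, §5.1). Infrastructure for route-1's rung leaf F-D1.A0
(a frontier FORMAL rung); NOT a proof of anomalous dissipation.
-/

set_option linter.dupNamespace false

namespace Summit.AnomalousDissipation.AnomalousDissipation.Theorems.SolenoidalFractalHomogenisation.LagrangianCarrierConstruction

open Summit.AnomalousDissipation.AnomalousDissipation.Theorems.SolenoidalFractalHomogenisation.LagrangianCarrier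
  (norm_comp_sub_id_le norm_le_one_add_norm_sub_id)

variable {V : Type*} [NormedAddCommGroup V] [NormedSpace ℝ V]

/-- A differentiable map with `‖Df − id‖ ≤ δ` everywhere has `‖Df‖ ≤ 1 + δ`. [folklore] -/
theorem norm_fderiv_le_one_add {f : V → V} {δ : ℝ}
    (hδ : ∀ z, ‖fderiv ℝ f z - ContinuousLinearMap.id ℝ V‖ ≤ δ) (z : V) : ‖fderiv ℝ f z‖ ≤ 1 + δ :=
  (norm_le_one_add_norm_sub_id _).trans (by linarith [hδ z])

/-- A differentiable map with `‖Df − id‖ ≤ δ` everywhere is `(1 + δ)`-Lipschitz. [folklore] -/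
theorem lipschitzWith_of_norm_fderiv_sub_id_le {f : V → V} (hf : Differentiable ℝ f) {δ : ℝ}
    (hδ : ∀ z, ‖fderiv ℝ f z - ContinuousLinearMap.id ℝ V‖ ≤ δ) :
    LipschitzWith (Real.toNNReal (1 + δ)) f := by
  refine lipschitzWith_of_nnnorm_fderiv_le hf fun z => ?_
  have h : ‖fderiv ℝ f z‖ ≤ 1 + δ := norm_fderiv_le_one_add hδ z
  rw [← NNReal.coe_le_coe, coe_nnnorm, Real.coe_toNNReal']
  exact h.trans (le_max_left _ _)

/-- Distance version: `‖f z − f z'‖ ≤ (1 + δ) ‖z − z'‖`. [folklore] -/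
theorem norm_sub_le_of_norm_fderiv_sub_id_le {f : V → V} (hf : Differentiable ℝ f) {δ : ℝ}
    (hδ : ∀ z, ‖fderiv ℝ f z - ContinuousLinearMap.id ℝ V‖ ≤ δ) (z z' : V) :
    ‖f z - f z'‖ ≤ (1 + δ) * ‖z - z'‖ := by
  have hδ0 : 0 ≤ 1 + δ := by linarith [(norm_nonneg _).trans (hδ z)]
  have h := (lipschitzWith_of_norm_fderiv_sub_id_le hf hδ).dist_le_mul z z'
  rwa [dist_eq_norm, dist_eq_norm, Real.coe_toNNReal _ hδ0] at h

/-- **Distortion of a composition**: `‖D(f ∘ g)(z) − id‖ ≤ δ_f + δ_g + δ_f δ_g`. [folklore] -/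
theorem norm_fderiv_comp_sub_id_le {f g : V → V} (hf : Differentiable ℝ f) (hg : Differentiable ℝ g) {δf δg : ℝ}
    (hδf : ∀ z, ‖fderiv ℝ f z - ContinuousLinearMap.id ℝ V‖ ≤ δf)
    (hδg : ∀ z, ‖fderiv ℝ g z - ContinuousLinearMap.id ℝ V‖ ≤ δg) (z : V) :
    ‖fderiv ℝ (f ∘ g) z - ContinuousLinearMap.id ℝ V‖ ≤ δf + δg + δf * δg := by
  rw [fderiv_comp z (hf _) (hg z)]
  have hδf0 : 0 ≤ δf := (norm_nonneg _).trans (hδf z)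
  calc ‖(fderiv ℝ f (g z)).comp (fderiv ℝ g z) - ContinuousLinearMap.id ℝ V‖
      ≤ ‖fderiv ℝ f (g z) - ContinuousLinearMap.id ℝ V‖ + ‖fderiv ℝ g z - ContinuousLinearMap.id ℝ V‖ +
          ‖fderiv ℝ f (g z) - ContinuousLinearMap.id ℝ V‖ * ‖fderiv ℝ g z - ContinuousLinearMap.id ℝ V‖ :=
        norm_comp_sub_id_le _ _
    _ ≤ δf + δg + δf * δg := by
        have h1 := hδf (g z)
        have h2 := hδg z
        have := mul_le_mul h1 h2 (norm_nonneg _) hδf0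
        linarith

/-- **Curvature of a composition**: `‖D(f ∘ g)(z) − D(f ∘ g)(z')‖ ≤ (β_f (1+δ_g)² + (1+δ_f) β_g) ‖z − z'‖`. [folklore] -/
theorem norm_fderiv_comp_sub_fderiv_comp_le {f g : V → V} (hf : Differentiable ℝ f) (hg : Differentiable ℝ g)
    {δf δg βf βg : ℝ} (hβf0 : 0 ≤ βf)
    (hδf : ∀ z, ‖fderiv ℝ f z - ContinuousLinearMap.id ℝ V‖ ≤ δf)
    (hδg : ∀ z, ‖fderiv ℝ g z - ContinuousLinearMap.id ℝ V‖ ≤ δg)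
    (hβf : ∀ z z', ‖fderiv ℝ f z - fderiv ℝ f z'‖ ≤ βf * ‖z - z'‖)
    (hβg : ∀ z z', ‖fderiv ℝ g z - fderiv ℝ g z'‖ ≤ βg * ‖z - z'‖) (z z' : V) :
    ‖fderiv ℝ (f ∘ g) z - fderiv ℝ (f ∘ g) z'‖ ≤ (βf * (1 + δg) ^ 2 + (1 + δf) * βg) * ‖z - z'‖ := by
  rw [fderiv_comp z (hf _) (hg z), fderiv_comp z' (hf _) (hg z')]
  have hδg1 : 0 ≤ 1 + δg := by linarith [(norm_nonneg _).trans (hδg z)]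
  have hδf1 : 0 ≤ 1 + δf := by linarith [(norm_nonneg _).trans (hδf z)]
  have hA : ‖fderiv ℝ f (g z) - fderiv ℝ f (g z')‖ ≤ βf * ((1 + δg) * ‖z - z'‖) :=
    (hβf _ _).trans (mul_le_mul_of_nonneg_left (norm_sub_le_of_norm_fderiv_sub_id_le hg hδg z z') hβf0)
  have hB : ‖fderiv ℝ g z - fderiv ℝ g z'‖ ≤ βg * ‖z - z'‖ := hβg z z'
  have hFg : ‖fderiv ℝ f (g z')‖ ≤ 1 + δf := norm_fderiv_le_one_add hδf _
  have hG : ‖fderiv ℝ g z‖ ≤ 1 + δg := norm_fderiv_le_one_add hδg _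
  -- `A B − A' B' = (A − A') B + A' (B − B')`
  have e : (fderiv ℝ f (g z)).comp (fderiv ℝ g z) - (fderiv ℝ f (g z')).comp (fderiv ℝ g z') =
      (fderiv ℝ f (g z) - fderiv ℝ f (g z')).comp (fderiv ℝ g z) +
        (fderiv ℝ f (g z')).comp (fderiv ℝ g z - fderiv ℝ g z') := by
    rw [ContinuousLinearMap.sub_comp, ContinuousLinearMap.comp_sub]; abel
  rw [e]
  calc ‖(fderiv ℝ f (g z) - fderiv ℝ f (g z')).comp (fderiv ℝ g z) +
        (fderiv ℝ f (g z')).comp (fderiv ℝ g z - fderiv ℝ g z')‖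
      ≤ ‖fderiv ℝ f (g z) - fderiv ℝ f (g z')‖ * ‖fderiv ℝ g z‖ +
          ‖fderiv ℝ f (g z')‖ * ‖fderiv ℝ g z - fderiv ℝ g z'‖ :=
        (norm_add_le _ _).trans (add_le_add (ContinuousLinearMap.opNorm_comp_le _ _) (ContinuousLinearMap.opNorm_comp_le _ _))
    _ ≤ βf * ((1 + δg) * ‖z - z'‖) * (1 + δg) + (1 + δf) * (βg * ‖z - z'‖) := by
        gcongr
    _ = (βf * (1 + δg) ^ 2 + (1 + δf) * βg) * ‖z - z'‖ := by ring

/-- **Conjugated insertion.** Let `f ∘ g = h`. If `‖Df − id‖ ≤ δ_f`, `‖Df(y) − Df(y')‖ ≤ β_f ‖y − y'‖`, `‖Dg − id‖ ≤ δ_g`, and the inserted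
map `ψ` satisfies `‖Dψ − id‖ ≤ ε` and `‖ψ(y) − y‖ ≤ η`, then
`‖D(f ∘ ψ ∘ g)(z) − id‖ ≤ (1+δ_f) ε (1+δ_g) + β_f η (1+δ_g) + ‖Dh(z) − id‖`
(`Df(ψgz) Dψ(gz) Dg(z) − id = Df(ψgz)(Dψ(gz) − id)Dg(z) + (Df(ψgz) − Df(gz))Dg(z) + (Dh(z) − id)`).
[cite: ArmstrongVicol2025, §5.1 (flow estimates on nested refresh windows)] -/
theorem norm_fderiv_conj_sub_id_le {f g ψ h : V → V} (hf : Differentiable ℝ f) (hg : Differentiable ℝ g)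
    (hψ : Differentiable ℝ ψ) (hfg : ∀ z, f (g z) = h z) {δf δg βf ε η : ℝ} (hβf0 : 0 ≤ βf)
    (hδf : ∀ z, ‖fderiv ℝ f z - ContinuousLinearMap.id ℝ V‖ ≤ δf)
    (hδg : ∀ z, ‖fderiv ℝ g z - ContinuousLinearMap.id ℝ V‖ ≤ δg)
    (hβf : ∀ z z', ‖fderiv ℝ f z - fderiv ℝ f z'‖ ≤ βf * ‖z - z'‖)
    (hε : ∀ z, ‖fderiv ℝ ψ z - ContinuousLinearMap.id ℝ V‖ ≤ ε) (hη : ∀ z, ‖ψ z - z‖ ≤ η) (z : V) :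
    ‖fderiv ℝ (f ∘ ψ ∘ g) z - ContinuousLinearMap.id ℝ V‖ ≤
      (1 + δf) * ε * (1 + δg) + βf * η * (1 + δg) + ‖fderiv ℝ h z - ContinuousLinearMap.id ℝ V‖ := by
  have hfg' : f ∘ g = h := funext hfg
  have hDh : fderiv ℝ h z = (fderiv ℝ f (g z)).comp (fderiv ℝ g z) := by
    rw [← hfg', fderiv_comp z (hf _) (hg z)]
  have hcomp : fderiv ℝ (f ∘ ψ ∘ g) z = ((fderiv ℝ f (ψ (g z))).comp (fderiv ℝ ψ (g z))).comp (fderiv ℝ g z) := by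
    rw [show f ∘ ψ ∘ g = (f ∘ ψ) ∘ g from rfl, fderiv_comp z ((hf _).comp _ (hψ _)) (hg z),
      fderiv_comp (g z) (hf _) (hψ _)]
  set A := fderiv ℝ f (ψ (g z)) with hA
  set A' := fderiv ℝ f (g z) with hA'
  set B := fderiv ℝ ψ (g z) with hB
  set C := fderiv ℝ g z with hC
  have hδg1 : 0 ≤ 1 + δg := by linarith [(norm_nonneg _).trans (hδg z)]
  have hδf1 : 0 ≤ 1 + δf := by linarith [(norm_nonneg _).trans (hδf z)]
  have hnA : ‖A‖ ≤ 1 + δf := norm_fderiv_le_one_add hδf _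
  have hnC : ‖C‖ ≤ 1 + δg := norm_fderiv_le_one_add hδg _
  have hAA' : ‖A - A'‖ ≤ βf * η := (hβf _ _).trans (mul_le_mul_of_nonneg_left (hη _) hβf0)
  have e : (A.comp B).comp C - ContinuousLinearMap.id ℝ V =
      (A.comp (B - ContinuousLinearMap.id ℝ V)).comp C + (A - A').comp C + (A'.comp C - ContinuousLinearMap.id ℝ V) := by
    rw [ContinuousLinearMap.comp_sub, ContinuousLinearMap.sub_comp, ContinuousLinearMap.sub_comp,
      ContinuousLinearMap.comp_id]
    abel
  rw [hcomp, e, hDh]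
  calc ‖(A.comp (B - ContinuousLinearMap.id ℝ V)).comp C + (A - A').comp C + (A'.comp C - ContinuousLinearMap.id ℝ V)‖
      ≤ ‖(A.comp (B - ContinuousLinearMap.id ℝ V)).comp C‖ + ‖(A - A').comp C‖ +
          ‖A'.comp C - ContinuousLinearMap.id ℝ V‖ := norm_add₃_le
    _ ≤ ‖A‖ * ‖B - ContinuousLinearMap.id ℝ V‖ * ‖C‖ + ‖A - A'‖ * ‖C‖ + ‖A'.comp C - ContinuousLinearMap.id ℝ V‖ := by
        gcongr
        · exact (ContinuousLinearMap.opNorm_comp_le _ _).trans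
            (mul_le_mul_of_nonneg_right (ContinuousLinearMap.opNorm_comp_le _ _) (norm_nonneg _))
        · exact ContinuousLinearMap.opNorm_comp_le _ _
    _ ≤ (1 + δf) * ε * (1 + δg) + βf * η * (1 + δg) + ‖A'.comp C - ContinuousLinearMap.id ℝ V‖ := by
        gcongr
        · exact mul_nonneg hδf1 ((norm_nonneg _).trans (hε (g z)))
        · exact hε (g z)
        · exact mul_nonneg hβf0 ((norm_nonneg _).trans (hη (g z)))

end Summit.AnomalousDissipation.AnomalousDissipation.Theorems.SolenoidalFractalHomogenisation.LagrangianCarrierConstruction
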